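import Summits.BirchSwinnertonDyer.Rank1Residual.ManinAdditive.KodairaDiscUnitAtTwo
import Literature.NumberTheory.EllipticCurves.OggFormulaTameTypesTwoProofs
import Literature.NumberTheory.DiophantineGeometry.MinimalDiscriminantBaseChangeCongruence
import HarnessLib

/-!
# Valuation bookkeeping at `2` and Tate's normal forms IV / IV* over `ℚ` (cell bsd-f2-manin, P-desc-1, part 1/2)

TYPER HEADER (bsd-f2-manin-ty g16, 2026-08-29; P-desc-1 support file 1/2 — the ≤ 400-line rule splits the proof).  Theorem-only (the place of `ℤ` above `2` is written
`(primesEquiv (R := ℤ)).symm ⟨2, _⟩` throughout, no named abbreviation); the lemmas used by `KodairaDiscUnitAtTwoHolds.lean`: integer/odd-fraction bridges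
(`val_intCast_le_one`, `int_dvd_of_val_le`, `exists_odd_div_odd`, `val_sub_one_le_of_val_eq_one` — units are `≡ 1 (mod 2)`,
`val_sq_sub_one_le_of_val_eq_one` — unit squares are `≡ 1 (mod 8)`), the `ℚ`-models in Tate's normal forms at `2`
(`exists_model_IV`, `exists_model_IVstar`: Literature `kodairaSymbolAt_of_four_dvd_conductorNorm`,
`LocalIndex.exists_smul_a_of_kodairaSymbolOfMinimal_eq_IV(_star)_of_two`, `exists_variableChange_valuation_a_of_two`,
Silverman ATAEC IV.9.4) and the transport `W.Δ = u¹² Δ(C • W)` with `u` a `2`-adic unit and `Δ_min/2^k` odd (`model_transport`).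
Nothing about BSD is proved here; PARTITION 0.
-/

noncomputable section

open WeierstrassCurve IsDedekindDomain IsDedekindDomain.HeightOneSpectrum Rat.HeightOneSpectrum WithZero
open Literature.NumberTheory.EllipticCurves Literature.NumberTheory.DiophantineGeometry

namespace Summit.BirchSwinnertonDyer.Rank1Residual.ManinAdditive.KodairaDiscUnit

/-- Valuation bookkeeping at the place above `2` (`natGenerator_vTwo`). -/
theorem natGenerator_vTwo : natGenerator ((Rat.HeightOneSpectrum.primesEquiv (R := ℤ)).symm ⟨2, Nat.prime_two⟩) = 2 :=
  congrArg Subtype.val ((Rat.HeightOneSpectrum.primesEquiv (R := ℤ)).apply_symm_apply ⟨2, Nat.prime_two⟩)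

/-- Valuation bookkeeping at the place above `2` (`valuation_two_vTwo`). -/
theorem valuation_two_vTwo : ((Rat.HeightOneSpectrum.primesEquiv (R := ℤ)).symm ⟨2, Nat.prime_two⟩).valuation ℚ (2 : ℚ) = exp (-1 : ℤ) := by
  have h := WeierstrassCurve.intValuation_natGenerator ((Rat.HeightOneSpectrum.primesEquiv (R := ℤ)).symm ⟨2, Nat.prime_two⟩)
  rw [natGenerator_vTwo] at h
  rw [show (2 : ℚ) = algebraMap ℤ ℚ 2 by norm_num, HeightOneSpectrum.valuation_of_algebraMap]
  exact_mod_cast h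

/-- Step 1–2 of the plan: a `ℚ`-model in the IV normal form when `4 ∥ N` and `v₂(Δ_min) = 4`. -/
theorem exists_model_IV (W : WeierstrassCurve ℚ) [W.IsElliptic] [W.IsGloballyMinimal]
    (h4 : 2 ^ 2 ∣ W.conductorNorm ℤ) (h8 : ¬ 2 ^ 3 ∣ W.conductorNorm ℤ)
    (hv4 : padicValInt 2 W.minimalDiscriminantInt = 4) :
    ∃ C : VariableChange ℚ,
      ((Rat.HeightOneSpectrum.primesEquiv (R := ℤ)).symm ⟨2, Nat.prime_two⟩).valuation ℚ (C • W).a₁ ≤ exp (-(1 : ℕ) : ℤ) ∧ ((Rat.HeightOneSpectrum.primesEquiv (R := ℤ)).symm ⟨2, Nat.prime_two⟩).valuation ℚ (C • W).a₂ ≤ exp (-(1 : ℕ) : ℤ) ∧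
      ((Rat.HeightOneSpectrum.primesEquiv (R := ℤ)).symm ⟨2, Nat.prime_two⟩).valuation ℚ (C • W).a₃ = exp (-(1 : ℕ) : ℤ) ∧ ((Rat.HeightOneSpectrum.primesEquiv (R := ℤ)).symm ⟨2, Nat.prime_two⟩).valuation ℚ (C • W).a₄ ≤ exp (-(2 : ℕ) : ℤ) ∧
      ((Rat.HeightOneSpectrum.primesEquiv (R := ℤ)).symm ⟨2, Nat.prime_two⟩).valuation ℚ (C • W).a₆ ≤ exp (-(2 : ℕ) : ℤ) ∧ ((Rat.HeightOneSpectrum.primesEquiv (R := ℤ)).symm ⟨2, Nat.prime_two⟩).valuation ℚ (C • W).Δ = exp (-(4 : ℕ) : ℤ) := by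
  have hv := natGenerator_vTwo
  rcases W.kodairaSymbolAt_of_four_dvd_conductorNorm ((Rat.HeightOneSpectrum.primesEquiv (R := ℤ)).symm ⟨2, Nat.prime_two⟩) hv h4 h8 with ⟨hIV, -⟩ | ⟨-, h8'⟩
  · have h2 := valuation_two_vTwo
    have h2irr : Irreducible (2 : ((Rat.HeightOneSpectrum.primesEquiv (R := ℤ)).symm ⟨2, Nat.prime_two⟩).adicCompletionIntegers ℚ) := by
      have h := Rat.irreducible_natCast_natGenerator ((Rat.HeightOneSpectrum.primesEquiv (R := ℤ)).symm ⟨2, Nat.prime_two⟩)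
      rw [hv] at h
      simpa using h
    rw [kodairaSymbolAt_def] at hIV
    obtain ⟨D, h₁, h₂, ⟨γ, hγ, h₃⟩, h₄, h₆, hΔ⟩ :=
      LocalIndex.exists_smul_a_of_kodairaSymbolOfMinimal_eq_IV_of_two h2irr _ hIV
    have H := W.exists_variableChange_valuation_a_of_two ((Rat.HeightOneSpectrum.primesEquiv (R := ℤ)).symm ⟨2, Nat.prime_two⟩) h2 (k₁ := 1) (k₂ := 1) (k₃ := 1)
      (k₄ := 2) (k₆ := 2) (n := 4)
      ⟨D, by simpa using h₁, by simpa using h₂, ⟨γ, hγ, by simpa using h₃⟩, h₄, h₆, hΔ⟩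
    exact H.2
  · omega


/-! ### Valuation bookkeeping at `((Rat.HeightOneSpectrum.primesEquiv (R := ℤ)).symm ⟨2, Nat.prime_two⟩)` -/

/-- shorthand-free: `v := ((Rat.HeightOneSpectrum.primesEquiv (R := ℤ)).symm ⟨2, Nat.prime_two⟩).valuation ℚ`. Integers have valuation `≤ 1`. -/
theorem val_intCast_le_one (n : ℤ) : ((Rat.HeightOneSpectrum.primesEquiv (R := ℤ)).symm ⟨2, Nat.prime_two⟩).valuation ℚ (n : ℚ) ≤ 1 := by
  have := (Rat.valuation_intCast_le_exp_iff ((Rat.HeightOneSpectrum.primesEquiv (R := ℤ)).symm ⟨2, Nat.prime_two⟩) n 0).mpr (by simp)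
  simpa using this

/-- Valuation bookkeeping at the place above `2` (`val_natCast_le_one`). -/
theorem val_natCast_le_one (n : ℕ) : ((Rat.HeightOneSpectrum.primesEquiv (R := ℤ)).symm ⟨2, Nat.prime_two⟩).valuation ℚ (n : ℚ) ≤ 1 := by
  have := val_intCast_le_one (n : ℤ); simpa using this

/-- `v(2^k) = exp(-k)`. -/
theorem val_two_pow (k : ℕ) : ((Rat.HeightOneSpectrum.primesEquiv (R := ℤ)).symm ⟨2, Nat.prime_two⟩).valuation ℚ ((2 : ℚ) ^ k) = exp (-(k : ℤ)) := by
  rw [map_pow, valuation_two_vTwo, ← WithZero.exp_nsmul]; simp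

/-- `4 ∣ n` from `v(n) ≤ exp(-2)`, and similar: the integer bridge. -/
theorem int_dvd_of_val_le (n : ℤ) (k : ℕ) (h : ((Rat.HeightOneSpectrum.primesEquiv (R := ℤ)).symm ⟨2, Nat.prime_two⟩).valuation ℚ (n : ℚ) ≤ exp (-(k : ℤ))) :
    (2 : ℤ) ^ k ∣ n := by
  have := (Rat.valuation_intCast_le_exp_iff ((Rat.HeightOneSpectrum.primesEquiv (R := ℤ)).symm ⟨2, Nat.prime_two⟩) n k).mp h
  rwa [natGenerator_vTwo] at this

/-- Valuation bookkeeping at the place above `2` (`odd_of_val_eq_one`). -/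
theorem odd_of_val_eq_one (n : ℤ) (h : ((Rat.HeightOneSpectrum.primesEquiv (R := ℤ)).symm ⟨2, Nat.prime_two⟩).valuation ℚ (n : ℚ) = 1) : Odd n := by
  have := (Rat.valuation_intCast_eq_one_iff ((Rat.HeightOneSpectrum.primesEquiv (R := ℤ)).symm ⟨2, Nat.prime_two⟩) n).mp h
  rw [natGenerator_vTwo] at this
  rcases Int.even_or_odd n with he | ho
  · exact absurd (even_iff_two_dvd.mp he) (by exact_mod_cast this)
  · exact ho

/-- A rational of valuation `1` at `2` is a quotient of two odd integers. -/
theorem exists_odd_div_odd {y : ℚ} (hy : ((Rat.HeightOneSpectrum.primesEquiv (R := ℤ)).symm ⟨2, Nat.prime_two⟩).valuation ℚ y = 1) :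
    ∃ m n : ℤ, Odd m ∧ Odd n ∧ (n : ℚ) ≠ 0 ∧ y = m / n := by
  have hy0 : y ≠ 0 := by intro h; rw [h, map_zero] at hy; exact zero_ne_one hy
  have hnum0 : (y.num : ℚ) ≠ 0 := by exact_mod_cast Rat.num_ne_zero.mpr hy0
  have hden0 : ((y.den : ℤ) : ℚ) ≠ 0 := by exact_mod_cast y.den_ne_zero
  have hyq : y = (y.num : ℚ) / ((y.den : ℤ) : ℚ) := by push_cast; exact (Rat.num_div_den y).symm
  have hvn := val_intCast_le_one y.num
  have hvd := val_intCast_le_one (y.den : ℤ)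
  -- `v num = v den`, and not both even (coprime) ⇒ both odd
  have heq : ((Rat.HeightOneSpectrum.primesEquiv (R := ℤ)).symm ⟨2, Nat.prime_two⟩).valuation ℚ (y.num : ℚ) = ((Rat.HeightOneSpectrum.primesEquiv (R := ℤ)).symm ⟨2, Nat.prime_two⟩).valuation ℚ ((y.den : ℤ) : ℚ) := by
    have := hy
    rw [hyq, map_div₀, div_eq_one_iff_eq ((Valuation.ne_zero_iff _).mpr hden0)] at this
    exact this
  have hden_odd : Odd (y.den : ℤ) := by
    rcases Int.even_or_odd (y.den : ℤ) with he | ho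
    · exfalso
      have h2d : (2 : ℤ) ∣ (y.den : ℤ) := even_iff_two_dvd.mp he
      have hltd : ((Rat.HeightOneSpectrum.primesEquiv (R := ℤ)).symm ⟨2, Nat.prime_two⟩).valuation ℚ ((y.den : ℤ) : ℚ) < 1 := by
        rw [Rat.valuation_intCast_lt_one_iff ((Rat.HeightOneSpectrum.primesEquiv (R := ℤ)).symm ⟨2, Nat.prime_two⟩), natGenerator_vTwo]; exact_mod_cast h2d
      have hltn : ((Rat.HeightOneSpectrum.primesEquiv (R := ℤ)).symm ⟨2, Nat.prime_two⟩).valuation ℚ (y.num : ℚ) < 1 := heq ▸ hltd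
      rw [Rat.valuation_intCast_lt_one_iff ((Rat.HeightOneSpectrum.primesEquiv (R := ℤ)).symm ⟨2, Nat.prime_two⟩), natGenerator_vTwo] at hltn
      have h2n : (2 : ℤ) ∣ y.num := by exact_mod_cast hltn
      have hcop : Nat.gcd y.num.natAbs y.den = 1 := y.reduced
      have h2n' : 2 ∣ y.num.natAbs := by
        have := Int.natAbs_dvd_natAbs.mpr h2n
        simpa using this
      have h2d' : 2 ∣ y.den := by exact_mod_cast h2d
      have h2g : 2 ∣ Nat.gcd y.num.natAbs y.den := Nat.dvd_gcd h2n' h2d'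
      rw [hcop] at h2g
      exact absurd h2g (by norm_num)
    · exact ho
  have hnum_odd : Odd y.num := by
    apply odd_of_val_eq_one
    rw [heq, Rat.valuation_intCast_eq_one_iff ((Rat.HeightOneSpectrum.primesEquiv (R := ℤ)).symm ⟨2, Nat.prime_two⟩), natGenerator_vTwo]
    intro h2d
    exact (Int.not_even_iff_odd.mpr hden_odd) (even_iff_two_dvd.mpr (by exact_mod_cast h2d))
  exact ⟨y.num, y.den, hnum_odd, hden_odd, hden0, hyq⟩


/-! ### `2`-integral coordinates -/

/-- `x / 2^k` is `2`-integral when `v(x) ≤ exp(-k)`. -/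
theorem val_div_two_pow_le_one {x : ℚ} {k : ℕ} (h : ((Rat.HeightOneSpectrum.primesEquiv (R := ℤ)).symm ⟨2, Nat.prime_two⟩).valuation ℚ x ≤ exp (-(k : ℤ))) :
    ((Rat.HeightOneSpectrum.primesEquiv (R := ℤ)).symm ⟨2, Nat.prime_two⟩).valuation ℚ (x / 2 ^ k) ≤ 1 := by
  rw [map_div₀, val_two_pow]
  exact div_le_one_of_le₀ h zero_le

/-- Valuation bookkeeping at the place above `2` (`val_div_two_pow_eq_one`). -/
theorem val_div_two_pow_eq_one {x : ℚ} {k : ℕ} (h : ((Rat.HeightOneSpectrum.primesEquiv (R := ℤ)).symm ⟨2, Nat.prime_two⟩).valuation ℚ x = exp (-(k : ℤ))) :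
    ((Rat.HeightOneSpectrum.primesEquiv (R := ℤ)).symm ⟨2, Nat.prime_two⟩).valuation ℚ (x / 2 ^ k) = 1 := by
  rw [map_div₀, val_two_pow, h, div_self exp_ne_zero]

/-- valuation `1` survives `12`-th (or any nonzero) powers downwards. -/
theorem val_eq_one_of_pow {x : ℚ} {n : ℕ} (hn : n ≠ 0) (h : ((Rat.HeightOneSpectrum.primesEquiv (R := ℤ)).symm ⟨2, Nat.prime_two⟩).valuation ℚ x ^ n = 1) :
    ((Rat.HeightOneSpectrum.primesEquiv (R := ℤ)).symm ⟨2, Nat.prime_two⟩).valuation ℚ x = 1 := by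
  have hx : ((Rat.HeightOneSpectrum.primesEquiv (R := ℤ)).symm ⟨2, Nat.prime_two⟩).valuation ℚ x ≠ 0 := by
    intro h0; rw [h0, zero_pow hn] at h; exact zero_ne_one h
  obtain ⟨m, hm⟩ : ∃ m : ℤ, ((Rat.HeightOneSpectrum.primesEquiv (R := ℤ)).symm ⟨2, Nat.prime_two⟩).valuation ℚ x = exp m := ⟨_, (WithZero.exp_log hx).symm⟩
  rw [hm, ← WithZero.exp_nsmul, ← WithZero.exp_zero] at h
  have := WithZero.exp_injective h
  rw [nsmul_eq_mul, mul_eq_zero] at this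
  rcases this with h0 | h0
  · exact absurd (by exact_mod_cast h0) hn
  · rw [hm, h0, WithZero.exp_zero]

/-! ### Units mod `2` and mod `8`; the IV* model -/

/-- Units are `≡ 1 (mod 2)`: `v(z) = 1 ⇒ v(z - 1) ≤ exp(-1)`. -/
theorem val_sub_one_le_of_val_eq_one {z : ℚ} (hz : ((Rat.HeightOneSpectrum.primesEquiv (R := ℤ)).symm ⟨2, Nat.prime_two⟩).valuation ℚ z = 1) :
    ((Rat.HeightOneSpectrum.primesEquiv (R := ℤ)).symm ⟨2, Nat.prime_two⟩).valuation ℚ (z - 1) ≤ exp (-(1 : ℕ) : ℤ) := by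
  obtain ⟨m, n, hm, hn, hn0, rfl⟩ := exists_odd_div_odd hz
  have hvn : ((Rat.HeightOneSpectrum.primesEquiv (R := ℤ)).symm ⟨2, Nat.prime_two⟩).valuation ℚ (n : ℚ) = 1 := by
    rw [Rat.valuation_intCast_eq_one_iff ((Rat.HeightOneSpectrum.primesEquiv (R := ℤ)).symm ⟨2, Nat.prime_two⟩) n, natGenerator_vTwo]
    intro h2; exact (Int.not_even_iff_odd.mpr hn) (even_iff_two_dvd.mpr (by exact_mod_cast h2))
  have : (m : ℚ) / n - 1 = ((m - n : ℤ) : ℚ) / n := by push_cast; field_simp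
  rw [this, map_div₀, hvn, div_one]
  have h2 : (2 : ℤ) ^ 1 ∣ m - n := by rw [pow_one]; exact even_iff_two_dvd.mp (hm.sub_odd hn)
  have := (Rat.valuation_intCast_le_exp_iff ((Rat.HeightOneSpectrum.primesEquiv (R := ℤ)).symm ⟨2, Nat.prime_two⟩) (m - n) 1).mpr (by rwa [natGenerator_vTwo])
  exact_mod_cast this

/-- Unit squares are `≡ 1 (mod 8)`: `v(y) = 1 ⇒ v(y² - 1) ≤ exp(-3)`. -/
theorem val_sq_sub_one_le_of_val_eq_one {y : ℚ} (hy : ((Rat.HeightOneSpectrum.primesEquiv (R := ℤ)).symm ⟨2, Nat.prime_two⟩).valuation ℚ y = 1) :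
    ((Rat.HeightOneSpectrum.primesEquiv (R := ℤ)).symm ⟨2, Nat.prime_two⟩).valuation ℚ (y ^ 2 - 1) ≤ exp (-(3 : ℕ) : ℤ) := by
  obtain ⟨m, n, hm, hn, hn0, rfl⟩ := exists_odd_div_odd hy
  have hvn : ((Rat.HeightOneSpectrum.primesEquiv (R := ℤ)).symm ⟨2, Nat.prime_two⟩).valuation ℚ (n : ℚ) = 1 := by
    rw [Rat.valuation_intCast_eq_one_iff ((Rat.HeightOneSpectrum.primesEquiv (R := ℤ)).symm ⟨2, Nat.prime_two⟩) n, natGenerator_vTwo]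
    intro h2; exact (Int.not_even_iff_odd.mpr hn) (even_iff_two_dvd.mpr (by exact_mod_cast h2))
  have : ((m : ℚ) / n) ^ 2 - 1 = ((m ^ 2 - n ^ 2 : ℤ) : ℚ) / (n : ℚ) ^ 2 := by push_cast; field_simp
  rw [this, map_div₀, map_pow, hvn, one_pow, div_one]
  have h8 : (2 : ℤ) ^ 3 ∣ m ^ 2 - n ^ 2 := by
    obtain ⟨a, rfl⟩ := hm
    obtain ⟨b, rfl⟩ := hn
    obtain ⟨c, hc⟩ := Int.even_mul_succ_self a
    obtain ⟨e, he⟩ := Int.even_mul_succ_self b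
    exact ⟨c - e, by nlinarith [hc, he]⟩
  have := (Rat.valuation_intCast_le_exp_iff ((Rat.HeightOneSpectrum.primesEquiv (R := ℤ)).symm ⟨2, Nat.prime_two⟩) (m ^ 2 - n ^ 2) 3).mpr (by rwa [natGenerator_vTwo])
  exact_mod_cast this

/-- Step 1–2 for IV*: a `ℚ`-model in the IV* normal form when `4 ∥ N` and `v₂(Δ_min) = 8`. -/
theorem exists_model_IVstar (W : WeierstrassCurve ℚ) [W.IsElliptic] [W.IsGloballyMinimal]
    (h4 : 2 ^ 2 ∣ W.conductorNorm ℤ) (h8 : ¬ 2 ^ 3 ∣ W.conductorNorm ℤ)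
    (hv8 : padicValInt 2 W.minimalDiscriminantInt = 8) :
    ∃ C : VariableChange ℚ,
      ((Rat.HeightOneSpectrum.primesEquiv (R := ℤ)).symm ⟨2, Nat.prime_two⟩).valuation ℚ (C • W).a₁ ≤ exp (-(1 : ℕ) : ℤ) ∧ ((Rat.HeightOneSpectrum.primesEquiv (R := ℤ)).symm ⟨2, Nat.prime_two⟩).valuation ℚ (C • W).a₂ ≤ exp (-(2 : ℕ) : ℤ) ∧
      ((Rat.HeightOneSpectrum.primesEquiv (R := ℤ)).symm ⟨2, Nat.prime_two⟩).valuation ℚ (C • W).a₃ = exp (-(2 : ℕ) : ℤ) ∧ ((Rat.HeightOneSpectrum.primesEquiv (R := ℤ)).symm ⟨2, Nat.prime_two⟩).valuation ℚ (C • W).a₄ ≤ exp (-(3 : ℕ) : ℤ) ∧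
      ((Rat.HeightOneSpectrum.primesEquiv (R := ℤ)).symm ⟨2, Nat.prime_two⟩).valuation ℚ (C • W).a₆ ≤ exp (-(4 : ℕ) : ℤ) ∧ ((Rat.HeightOneSpectrum.primesEquiv (R := ℤ)).symm ⟨2, Nat.prime_two⟩).valuation ℚ (C • W).Δ = exp (-(8 : ℕ) : ℤ) := by
  have hv := natGenerator_vTwo
  rcases W.kodairaSymbolAt_of_four_dvd_conductorNorm ((Rat.HeightOneSpectrum.primesEquiv (R := ℤ)).symm ⟨2, Nat.prime_two⟩) hv h4 h8 with ⟨-, h4'⟩ | ⟨hT, -⟩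
  · have h44 : padicValInt 2 W.minimalDiscriminantInt = 4 := h4'
    omega
  · have h2 := valuation_two_vTwo
    have h2irr : Irreducible (2 : ((Rat.HeightOneSpectrum.primesEquiv (R := ℤ)).symm ⟨2, Nat.prime_two⟩).adicCompletionIntegers ℚ) := by
      have h := Rat.irreducible_natCast_natGenerator ((Rat.HeightOneSpectrum.primesEquiv (R := ℤ)).symm ⟨2, Nat.prime_two⟩)
      rw [hv] at h
      simpa using h
    rw [kodairaSymbolAt_def] at hT
    obtain ⟨D, h₁, h₂, ⟨γ, hγ, h₃⟩, h₄, h₆, hΔ⟩ :=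
      LocalIndex.exists_smul_a_of_kodairaSymbolOfMinimal_eq_IVstar_of_two h2irr _ hT
    have H := W.exists_variableChange_valuation_a_of_two ((Rat.HeightOneSpectrum.primesEquiv (R := ℤ)).symm ⟨2, Nat.prime_two⟩) h2 (k₁ := 1) (k₂ := 2) (k₃ := 2)
      (k₄ := 3) (k₆ := 4) (n := 8)
      ⟨D, by simpa using h₁, h₂, ⟨γ, hγ, h₃⟩, h₄, h₆, hΔ⟩
    exact H.2

/-! ### Transport to the minimal discriminant -/

/-- Transport along `X = C • W`: if `v₂(Δ_min) = k` and `v(Δ(C • W)) = exp(-k)` then `u = C.u` is a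
`2`-adic unit and `2^k · (Δ_min / 2^k) = u¹² Δ(C • W)` in `ℚ`, with `Δ_min / 2^k` odd. -/
theorem model_transport (W : WeierstrassCurve ℚ) [W.IsElliptic] [W.IsGloballyMinimal] (C : VariableChange ℚ) {k : ℕ}
    (hvk : padicValInt 2 W.minimalDiscriminantInt = k)
    (hΔX : ((Rat.HeightOneSpectrum.primesEquiv (R := ℤ)).symm ⟨2, Nat.prime_two⟩).valuation ℚ (C • W).Δ = exp (-(k : ℤ))) :
    ((Rat.HeightOneSpectrum.primesEquiv (R := ℤ)).symm ⟨2, Nat.prime_two⟩).valuation ℚ (C.u : ℚ) = 1 ∧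
      ((2 : ℚ) ^ k * ((W.minimalDiscriminantInt / 2 ^ k : ℤ) : ℚ)) = (C.u : ℚ) ^ 12 * (C • W).Δ := by
  set Δm := W.minimalDiscriminantInt with hΔm
  have hΔm0 : Δm ≠ 0 := by
    intro h0
    have hc := W.cast_minimalDiscriminantInt
    rw [← hΔm, h0, Int.cast_zero] at hc
    exact W.isUnit_Δ.ne_zero hc.symm
  have h2k : (2 : ℤ) ^ k ∣ Δm := (padicValInt_dvd_iff (p := 2) k Δm).mpr (Or.inr hvk.ge)
  obtain ⟨d, hd⟩ := h2k
  have hdiv : Δm / 2 ^ k = d := by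
    rw [hd]; exact Int.mul_ediv_cancel_left _ (pow_ne_zero _ (by norm_num))
  rw [hdiv]
  -- `d` is odd, so `v(d) = 1`
  have hd_odd : ¬ (2 : ℤ) ∣ d := by
    rintro ⟨e, rfl⟩
    have h2k1 : (2 : ℤ) ^ (k + 1) ∣ Δm := ⟨e, by rw [hd]; ring⟩
    rcases (padicValInt_dvd_iff (p := 2) (k + 1) Δm).mp h2k1 with h0 | h5
    · exact hΔm0 h0
    · have h5' : k + 1 ≤ padicValInt 2 Δm := h5
      have hkk : padicValInt 2 Δm = k := hvk
      omega
  have hvd : ((Rat.HeightOneSpectrum.primesEquiv (R := ℤ)).symm ⟨2, Nat.prime_two⟩).valuation ℚ (d : ℚ) = 1 := by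
    rw [Rat.valuation_intCast_eq_one_iff ((Rat.HeightOneSpectrum.primesEquiv (R := ℤ)).symm ⟨2, Nat.prime_two⟩) d, natGenerator_vTwo]; exact_mod_cast hd_odd
  have hWΔ : W.Δ = (C.u : ℚ) ^ 12 * (C • W).Δ := by
    rw [variableChange_Δ, ← mul_assoc, ← mul_pow, Units.mul_inv, one_pow, one_mul]
  have hd' : ((2 : ℚ) ^ k * d) = (C.u : ℚ) ^ 12 * (C • W).Δ := by
    rw [← hWΔ, ← W.cast_minimalDiscriminantInt, ← hΔm, hd]; push_cast; ring
  refine ⟨?_, hd'⟩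
  apply val_eq_one_of_pow (n := 12) (by norm_num)
  have hv2kd : ((Rat.HeightOneSpectrum.primesEquiv (R := ℤ)).symm ⟨2, Nat.prime_two⟩).valuation ℚ ((2 : ℚ) ^ k * d) = exp (-(k : ℤ)) := by
    rw [map_mul, val_two_pow, hvd, mul_one]
  rw [hd', map_mul, map_pow, hΔX] at hv2kd
  have hne : (exp (-(k : ℤ)) : ℤᵐ⁰) ≠ 0 := exp_ne_zero
  calc ((Rat.HeightOneSpectrum.primesEquiv (R := ℤ)).symm ⟨2, Nat.prime_two⟩).valuation ℚ (C.u : ℚ) ^ 12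
      = ((Rat.HeightOneSpectrum.primesEquiv (R := ℤ)).symm ⟨2, Nat.prime_two⟩).valuation ℚ (C.u : ℚ) ^ 12 * exp (-(k : ℤ)) / exp (-(k : ℤ)) := by
        rw [mul_div_assoc, div_self hne, mul_one]
    _ = 1 := by rw [hv2kd, div_self hne]

end Summit.BirchSwinnertonDyer.Rank1Residual.ManinAdditive.KodairaDiscUnit

end
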